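import Summits.HubbardSuperconductivity.HubbardLadder.ObservableWindowAbstract
import HarnessLib

/-!
# Rung R2 — soundness of the energy-window observable certificate, part 2/3 (vector and sector states)

HONEST FRAMING (page 1): ladder R1–R4 with certified numbers; no claim on H/H₀.
(The r2 seat's `ObservableWindow` split into three files for the 400-line limit, statements unchanged:
`ObservableWindowAbstract` = §1 window arithmetic, §2 abstract `⋆`-algebra certificate lemmas, §3a tracial
ground-state instances; `ObservableWindowVector` = §3b eigenvector / sector-ground-state / symmetrised
instances; `ObservableWindow` = §4 Hubbard rows + §5 Heisenberg rows and the full overview docstring;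
import `ObservableWindow` to get everything.)

This part: the same certificate read in a unit energy eigenvector (`re_vectorState_ge/le_of_windowCertificate[_residual]`;
null terms = commutators + sector annihilators `Y Z + Z' Y'`, NO symmetry defects), trial-state energy windows
(`minEnergyOn_le_of_trialState`, `groundEnergy_le_of_trialState`), every sector ground state
(`re_expect_ge_of_windowCertificate_of_sectorGS`, `re_expect_ge_of_minEnergyOn_add_smul`), and the
symmetrised form `re_vectorState_ge_of_windowCertificate_symm` (`orbitVectorState`): symmetry-defect null
terms ARE sound for every sector ground state when the objective is invariant under the finite unitary family.
No certificate exists; these are soundness edges.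
-/

namespace Summit.HubbardSuperconductivity.HubbardLadder

open Matrix Finset Filter Literature.Probability.LatticeModels
  Literature.MathematicalPhysics.QuantumLattice
  Literature.MathematicalPhysics.QuantumManyBody.StateRelaxation
open scoped ComplexOrder

noncomputable section

/-! ## §3 (continued) Matrix instances: energy eigenvectors, sector ground states, symmetrised vector states -/

section MatrixInstances

variable {n : Type*} [Fintype n] [DecidableEq n]
variable {m : Type*} [Fintype m] [DecidableEq m]

/-- **Window certificate ⇒ observable lower bound in an energy eigenvector (sector form).** For
Hermitian `A`, a unit eigenvector `A v = E v` with `E ≤ E_up`: an identity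
`V - c·1 = Σᵢⱼ Λᵢⱼ Oᵢᴴ Oⱼ + (Σₖ (A Xₖ - Xₖ A) + Σₗ (Yₗ Zₗ + Z'ₗ Y'ₗ)) + μ·(E_up·1 - A)` with `Λ ⪰ 0`,
`μ ≥ 0`, `Zₗ v = 0`, `Z'ₗᴴ v = 0` proves `c ≤ Re ⟨v, V v⟩`. No symmetry-defect null terms: a vector
state is not symmetric in general. [cite: WangEtAl2024, §3 eq. (4)] [cite: RubinLowDePrince2026, §III.A] -/
theorem re_vectorState_ge_of_windowCertificate {A : Matrix n n ℂ} (hA : A.IsHermitian) {E : ℝ}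
    {v : n → ℂ} (hv : star v ⬝ᵥ v = 1) (hAv : A *ᵥ v = (E : ℂ) • v)
    {Λ : Matrix m m ℂ} (hΛ : Λ.PosSemidef) (O : m → Matrix n n ℂ)
    {κ : Type*} (s : Finset κ) (X : κ → Matrix n n ℂ)
    {ι : Type*} (t : Finset ι) (Y Z Z' Y' : ι → Matrix n n ℂ)
    (hZ : ∀ l ∈ t, Z l *ᵥ v = 0) (hZ' : ∀ l ∈ t, (Z' l)ᴴ *ᵥ v = 0)
    {V : Matrix n n ℂ} {Eup μ c : ℝ} (hμ : 0 ≤ μ) (hE : E ≤ Eup)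
    (hcert : V - (c : ℂ) • (1 : Matrix n n ℂ) =
      gramForm Λ O + (∑ k ∈ s, (A * X k - X k * A) + ∑ l ∈ t, (Y l * Z l + Z' l * Y' l)) +
        (μ : ℂ) • ((Eup : ℂ) • (1 : Matrix n n ℂ) - A)) :
    c ≤ (star v ⬝ᵥ V *ᵥ v).re := by
  set ω := vectorState v with hω
  have hpos : ∀ a : Matrix n n ℂ, 0 ≤ ω (star a * a) := fun a => vectorState_nonneg v a
  have hone : ω 1 = 1 := by rw [hω, vectorState_apply, one_mulVec, hv]
  have hnull : ω (∑ k ∈ s, (A * X k - X k * A) + ∑ l ∈ t, (Y l * Z l + Z' l * Y' l)) = 0 := by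
    rw [map_add, map_sum, map_sum]
    have h1 : ∀ k ∈ s, ω (A * X k - X k * A) = 0 := fun k _ => vectorState_commutator hA hAv _
    have h2 : ∀ l ∈ t, ω (Y l * Z l + Z' l * Y' l) = 0 := fun l hl => by
      rw [map_add, hω, vectorState_mul_of_mulVec_eq_zero v _ (hZ l hl),
        vectorState_mul_of_conjTranspose_mulVec_eq_zero v _ (hZ' l hl), add_zero]
    rw [Finset.sum_eq_zero h1, Finset.sum_eq_zero h2, add_zero]
  have hE' : (ω A).re ≤ Eup := by
    rw [hω, vectorState_apply, hAv, dotProduct_smul, hv, smul_eq_mul, mul_one, Complex.ofReal_re]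
    exact hE
  have h := le_re_map_of_windowCertificate ω hpos hone hΛ O hnull hμ hE' hcert
  rwa [hω, vectorState_apply] at h

/-- **Rounded window certificate (eigenvector form)**: as `re_vectorState_ge_of_windowCertificate`
with a residual `r`, `-ε ≤ Re ⟨v, r v⟩` ⇒ `c - ε ≤ Re ⟨v, V v⟩`. [cite: KullEtAl2024, §5.3] -/
theorem re_vectorState_ge_of_windowCertificate_residual {A : Matrix n n ℂ} (hA : A.IsHermitian)
    {E : ℝ} {v : n → ℂ} (hv : star v ⬝ᵥ v = 1) (hAv : A *ᵥ v = (E : ℂ) • v)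
    {Λ : Matrix m m ℂ} (hΛ : Λ.PosSemidef) (O : m → Matrix n n ℂ)
    {κ : Type*} (s : Finset κ) (X : κ → Matrix n n ℂ)
    {ι : Type*} (t : Finset ι) (Y Z Z' Y' : ι → Matrix n n ℂ)
    (hZ : ∀ l ∈ t, Z l *ᵥ v = 0) (hZ' : ∀ l ∈ t, (Z' l)ᴴ *ᵥ v = 0)
    {V r : Matrix n n ℂ} {ε : ℝ} (hr : -ε ≤ (star v ⬝ᵥ r *ᵥ v).re)
    {Eup μ c : ℝ} (hμ : 0 ≤ μ) (hE : E ≤ Eup)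
    (hcert : V - (c : ℂ) • (1 : Matrix n n ℂ) =
      gramForm Λ O + (∑ k ∈ s, (A * X k - X k * A) + ∑ l ∈ t, (Y l * Z l + Z' l * Y' l)) +
        (μ : ℂ) • ((Eup : ℂ) • (1 : Matrix n n ℂ) - A) + r) :
    c - ε ≤ (star v ⬝ᵥ V *ᵥ v).re := by
  set ω := vectorState v with hω
  have hpos : ∀ a : Matrix n n ℂ, 0 ≤ ω (star a * a) := fun a => vectorState_nonneg v a
  have hone : ω 1 = 1 := by rw [hω, vectorState_apply, one_mulVec, hv]
  have hnull : ω (∑ k ∈ s, (A * X k - X k * A) + ∑ l ∈ t, (Y l * Z l + Z' l * Y' l)) = 0 := by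
    rw [map_add, map_sum, map_sum]
    have h1 : ∀ k ∈ s, ω (A * X k - X k * A) = 0 := fun k _ => vectorState_commutator hA hAv _
    have h2 : ∀ l ∈ t, ω (Y l * Z l + Z' l * Y' l) = 0 := fun l hl => by
      rw [map_add, hω, vectorState_mul_of_mulVec_eq_zero v _ (hZ l hl),
        vectorState_mul_of_conjTranspose_mulVec_eq_zero v _ (hZ' l hl), add_zero]
    rw [Finset.sum_eq_zero h1, Finset.sum_eq_zero h2, add_zero]
  have hE' : (ω A).re ≤ Eup := by
    rw [hω, vectorState_apply, hAv, dotProduct_smul, hv, smul_eq_mul, mul_one, Complex.ofReal_re]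
    exact hE
  have hr' : -ε ≤ (ω r).re := by rw [hω, vectorState_apply]; exact hr
  have h := le_re_map_of_windowCertificate_residual ω hpos hone hΛ O hnull hr' hμ hE' hcert
  rwa [hω, vectorState_apply] at h

/-- Upper-bound reading in an eigenvector: a window certificate for `-V` gives `Re ⟨v, V v⟩ ≤ -c`.
[cite: WangEtAl2024, §3 eq. (4)] -/
theorem re_vectorState_le_of_windowCertificate {A : Matrix n n ℂ} (hA : A.IsHermitian) {E : ℝ}
    {v : n → ℂ} (hv : star v ⬝ᵥ v = 1) (hAv : A *ᵥ v = (E : ℂ) • v)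
    {Λ : Matrix m m ℂ} (hΛ : Λ.PosSemidef) (O : m → Matrix n n ℂ)
    {κ : Type*} (s : Finset κ) (X : κ → Matrix n n ℂ)
    {ι : Type*} (t : Finset ι) (Y Z Z' Y' : ι → Matrix n n ℂ)
    (hZ : ∀ l ∈ t, Z l *ᵥ v = 0) (hZ' : ∀ l ∈ t, (Z' l)ᴴ *ᵥ v = 0)
    {V : Matrix n n ℂ} {Eup μ c : ℝ} (hμ : 0 ≤ μ) (hE : E ≤ Eup)
    (hcert : -V - (c : ℂ) • (1 : Matrix n n ℂ) =
      gramForm Λ O + (∑ k ∈ s, (A * X k - X k * A) + ∑ l ∈ t, (Y l * Z l + Z' l * Y' l)) +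
        (μ : ℂ) • ((Eup : ℂ) • (1 : Matrix n n ℂ) - A)) :
    (star v ⬝ᵥ V *ᵥ v).re ≤ -c := by
  have h := re_vectorState_ge_of_windowCertificate hA hv hAv hΛ O s X t Y Z Z' Y' hZ hZ' hμ hE hcert
  rw [neg_mulVec, dotProduct_neg, Complex.neg_re] at h
  linarith

/-- A certified trial state in the sector discharges the energy-window hypothesis:
`φ ∈ K`, `‖φ‖ = 1`, `Re ⟨φ, A φ⟩ ≤ E_up` ⇒ `minEnergyOn A K ≤ E_up` (R1's Slater / Gram-projector
states in the `(N, S^z = 0)` sector). [folklore] -/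
theorem minEnergyOn_le_of_trialState {A : Matrix n n ℂ} (hA : A.IsHermitian)
    (K : Submodule ℂ (n → ℂ)) {φ : n → ℂ} (hφ : φ ∈ K) (h1 : star φ ⬝ᵥ φ = 1) {Eup : ℝ}
    (hray : (star φ ⬝ᵥ A *ᵥ φ).re ≤ Eup) : A.minEnergyOn K ≤ Eup :=
  (minEnergyOn_le_rayleigh_of_mem hA K hφ h1).trans hray

/-- A certified trial state discharges the global energy-window hypothesis of the tracial rows:
`‖φ‖ = 1`, `Re ⟨φ, A φ⟩ ≤ E_up` ⇒ `E₀(A) ≤ E_up` (R1's variational upper bounds; for the Heisenberg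
rows an MPS / Lanczos Rayleigh quotient evaluated exactly). [folklore] -/
theorem groundEnergy_le_of_trialState {A : Matrix n n ℂ} (hA : A.IsHermitian) {φ : n → ℂ}
    (h1 : star φ ⬝ᵥ φ = 1) {Eup : ℝ} (hray : (star φ ⬝ᵥ A *ᵥ φ).re ≤ Eup) :
    A.groundEnergy ≤ Eup :=
  (Matrix.groundEnergy_le_rayleigh_holds hA φ h1).trans hray

/-- **Window certificate ⇒ observable lower bound for EVERY sector ground state.** For Hermitian
`A`, a sector `K` with `minEnergyOn A K ≤ E_up`, annihilators valid on all of `K`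
(`Zₗ w = 0`, `Z'ₗᴴ w = 0` for `w ∈ K`) and a window certificate as in
`re_vectorState_ge_of_windowCertificate`: every unit `ψ ∈ K` with `A ψ = E_K ψ` has
`c ≤ Re ⟨ψ, V ψ⟩` — including degenerate sector ground levels. [cite: WangEtAl2024, §3 eq. (4)] -/
theorem re_expect_ge_of_windowCertificate_of_sectorGS {A : Matrix n n ℂ} (hA : A.IsHermitian)
    (K : Submodule ℂ (n → ℂ)) {Λ : Matrix m m ℂ} (hΛ : Λ.PosSemidef) (O : m → Matrix n n ℂ)
    {κ : Type*} (s : Finset κ) (X : κ → Matrix n n ℂ)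
    {ι : Type*} (t : Finset ι) (Y Z Z' Y' : ι → Matrix n n ℂ)
    (hZ : ∀ l ∈ t, ∀ w ∈ K, Z l *ᵥ w = 0) (hZ' : ∀ l ∈ t, ∀ w ∈ K, (Z' l)ᴴ *ᵥ w = 0)
    {V : Matrix n n ℂ} {Eup μ c : ℝ} (hμ : 0 ≤ μ) (hE : A.minEnergyOn K ≤ Eup)
    (hcert : V - (c : ℂ) • (1 : Matrix n n ℂ) =
      gramForm Λ O + (∑ k ∈ s, (A * X k - X k * A) + ∑ l ∈ t, (Y l * Z l + Z' l * Y' l)) +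
        (μ : ℂ) • ((Eup : ℂ) • (1 : Matrix n n ℂ) - A))
    {ψ : n → ℂ} (hψK : ψ ∈ K) (hψ1 : star ψ ⬝ᵥ ψ = 1)
    (hAψ : A *ᵥ ψ = ((A.minEnergyOn K : ℝ) : ℂ) • ψ) :
    c ≤ (star ψ ⬝ᵥ V *ᵥ ψ).re :=
  re_vectorState_ge_of_windowCertificate hA hψ1 hAψ hΛ O s X t Y Z Z' Y'
    (fun l hl => hZ l hl ψ hψK) (fun l hl => hZ' l hl ψ hψK) hμ hE hcert

/-- **Scan form for sector states (D1).** For Hermitian `A`, `V`, `λ > 0`, a sector `K` and ANY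
certified `c ≤ minEnergyOn (A + λV) K`: every unit `ψ ∈ K` of energy `Re ⟨ψ, A ψ⟩ ≤ E_up` has
`(c - E_up)/λ ≤ Re ⟨ψ, V ψ⟩` (sector variational principle `minEnergyOn_le_rayleigh_of_mem`).
[folklore] -/
theorem re_expect_ge_of_minEnergyOn_add_smul {A V : Matrix n n ℂ} (hA : A.IsHermitian)
    (hV : V.IsHermitian) (K : Submodule ℂ (n → ℂ)) {Eup lam c : ℝ} (hlam : 0 < lam)
    (hc : c ≤ (A + (lam : ℂ) • V).minEnergyOn K) {ψ : n → ℂ} (hψK : ψ ∈ K)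
    (hψ1 : star ψ ⬝ᵥ ψ = 1) (hE : (star ψ ⬝ᵥ A *ᵥ ψ).re ≤ Eup) :
    (c - Eup) / lam ≤ (star ψ ⬝ᵥ V *ᵥ ψ).re := by
  have hAV : (A + (lam : ℂ) • V).IsHermitian :=
    hA.add (IsHermitian.smul hV (by rw [isSelfAdjoint_iff, Complex.star_def, Complex.conj_ofReal]))
  have h := minEnergyOn_le_rayleigh_of_mem hAV K hψK hψ1
  rw [add_mulVec, smul_mulVec, dotProduct_add, dotProduct_smul, smul_eq_mul, Complex.add_re,
    Complex.re_ofReal_mul] at h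
  exact obs_lower_of_window hE (hc.trans h) hlam

/-! ### Symmetrised vector states: symmetry-defect null terms for EVERY sector ground state,
provided the objective is invariant -/

omit [DecidableEq n] in
/-- `⟨Uᴴ w, Y Uᴴ w⟩ = ⟨w, U Y Uᴴ w⟩`. [folklore] -/
theorem vectorState_conjTranspose_mulVec (U Y : Matrix n n ℂ) (w : n → ℂ) :
    vectorState (Uᴴ *ᵥ w) Y = vectorState w (U * Y * Uᴴ) := by
  rw [vectorState_apply, vectorState_apply, star_mulVec, conjTranspose_conjTranspose,
    ← dotProduct_mulVec, mulVec_mulVec, mulVec_mulVec]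

omit [DecidableEq n] in
/-- A unitary commuting with a Hermitian `A` maps eigenvectors to eigenvectors:
`A (Tᴴ v) = E (Tᴴ v)`. [folklore] -/
theorem conjTranspose_mulVec_eigenvector {A T : Matrix n n ℂ} (hTA' : Tᴴ * A = A * Tᴴ) {E : ℝ}
    {v : n → ℂ} (hAv : A *ᵥ v = (E : ℂ) • v) : A *ᵥ (Tᴴ *ᵥ v) = (E : ℂ) • (Tᴴ *ᵥ v) := by
  rw [mulVec_mulVec, ← hTA', ← mulVec_mulVec, hAv, mulVec_smul]

/-- The orbit-averaged vector state `X ↦ |G|⁻¹ Σ_g ⟨T_gᴴ v, X T_gᴴ v⟩` of a vector `v` under a finite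
family of matrices `T_g`. [folklore] -/
def orbitVectorState {G : Type*} [Fintype G] (T : G → Matrix n n ℂ) (v : n → ℂ) :
    Matrix n n ℂ →ₗ[ℂ] ℂ :=
  (Fintype.card G : ℂ)⁻¹ • ∑ g, vectorState ((T g)ᴴ *ᵥ v)

omit [DecidableEq n] in
/-- Unfolding `orbitVectorState`. [folklore] -/
theorem orbitVectorState_apply {G : Type*} [Fintype G] (T : G → Matrix n n ℂ) (v : n → ℂ)
    (X : Matrix n n ℂ) :
    orbitVectorState T v X = (Fintype.card G : ℂ)⁻¹ * ∑ g, vectorState ((T g)ᴴ *ᵥ v) X := by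
  simp only [orbitVectorState, LinearMap.smul_apply, LinearMap.coe_sum, Finset.sum_apply,
    smul_eq_mul]

/-- **Window certificate WITH symmetry-defect terms ⇒ bound for EVERY sector ground state, for an
INVARIANT objective.** Let `A` be Hermitian, `K` a sector, `v ∈ K` a unit eigenvector `A v = E v`
with `E ≤ E_up`; `T : G → unitaries` a finite nonempty family commuting with `A` whose adjoints
preserve `K` and which is closed under right multiplication by each certificate unitary `U_l`
(`T_g U_l = T_{σ_l g}` for a permutation `σ_l` — e.g. `T` a unitary representation of the lattice
translation / point group and `U_l ∈ T(G)`); `V` invariant, `T_g V T_gᴴ = V`. Then an identity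
`V - c·1 = Σ Λᵢⱼ Oᵢᴴ Oⱼ + (Σ_k (A X_k - X_k A) + Σ_l (U_l Y_l U_lᴴ - Y_l) + Σ_i (Y₁ᵢ Zᵢ + Z'ᵢ Y₂ᵢ))
 + μ·(E_up·1 - A)` (`Λ ⪰ 0`, `μ ≥ 0`, `Zᵢ`, `Z'ᵢᴴ` killing `K`) proves `c ≤ Re ⟨v, V v⟩` — the
symmetry constraints `⟨U O Uᴴ⟩ = ⟨O⟩` of a symmetry-reduced relaxation are SOUND for every
(possibly degenerate, non-symmetric) sector ground state as long as the OBJECTIVE is invariant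
(translation-averaged correlators `P̄_d(L, r)`, `m_s²`, `ḡ_L(N)`): evaluate the certificate in the
orbit-averaged state `|G|⁻¹ Σ_g ⟨T_gᴴ v, · T_gᴴ v⟩`, which is positive, normalised, has energy `E`,
kills all three null classes, and agrees with `⟨v, · v⟩` on invariant observables.
[cite: Han2020Bootstrap, §2 eq. (2)–(3)] [cite: WangEtAl2024, §3 eq. (4)] -/
theorem re_vectorState_ge_of_windowCertificate_symm {A : Matrix n n ℂ} (hA : A.IsHermitian)
    (K : Submodule ℂ (n → ℂ)) {E : ℝ} {v : n → ℂ} (hvK : v ∈ K) (hv : star v ⬝ᵥ v = 1)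
    (hAv : A *ᵥ v = (E : ℂ) • v)
    {G : Type*} [Fintype G] [Nonempty G] (T : G → Matrix n n ℂ)
    (hTA : ∀ g, T g * A = A * T g) (hTT : ∀ g, (T g)ᴴ * T g = 1)
    (hTK : ∀ g, ∀ w ∈ K, (T g)ᴴ *ᵥ w ∈ K)
    {Λ : Matrix m m ℂ} (hΛ : Λ.PosSemidef) (O : m → Matrix n n ℂ)
    {κ : Type*} (s : Finset κ) (X : κ → Matrix n n ℂ)
    {ι : Type*} (t : Finset ι) (U Y : ι → Matrix n n ℂ)
    (hUT : ∀ l ∈ t, ∃ σ : G ≃ G, ∀ g, T g * U l = T (σ g))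
    {ρ : Type*} (r : Finset ρ) (Y₁ Z Z' Y₂ : ρ → Matrix n n ℂ)
    (hZ : ∀ i ∈ r, ∀ w ∈ K, Z i *ᵥ w = 0) (hZ' : ∀ i ∈ r, ∀ w ∈ K, (Z' i)ᴴ *ᵥ w = 0)
    {V : Matrix n n ℂ} (hV : ∀ g, T g * V * (T g)ᴴ = V) {Eup μ c : ℝ} (hμ : 0 ≤ μ) (hE : E ≤ Eup)
    (hcert : V - (c : ℂ) • (1 : Matrix n n ℂ) =
      gramForm Λ O + (∑ k ∈ s, (A * X k - X k * A) + ∑ l ∈ t, (U l * Y l * (U l)ᴴ - Y l) +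
          ∑ i ∈ r, (Y₁ i * Z i + Z' i * Y₂ i)) +
        (μ : ℂ) • ((Eup : ℂ) • (1 : Matrix n n ℂ) - A)) :
    c ≤ (star v ⬝ᵥ V *ᵥ v).re := by
  -- the orbit vectors `w g = T_gᴴ v`: unit eigenvectors in `K`
  have hTT' : ∀ g, T g * (T g)ᴴ = 1 := fun g => mul_eq_one_comm.mp (hTT g)
  have hTA' : ∀ g, (T g)ᴴ * A = A * (T g)ᴴ := fun g =>
    Matrix.conjTranspose_commute_of_commute hA (hTA g)
  have hw1 : ∀ g, star ((T g)ᴴ *ᵥ v) ⬝ᵥ ((T g)ᴴ *ᵥ v) = 1 := fun g => by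
    rw [star_mulVec, conjTranspose_conjTranspose, ← dotProduct_mulVec, mulVec_mulVec, hTT' g,
      one_mulVec, hv]
  have hAw : ∀ g, A *ᵥ ((T g)ᴴ *ᵥ v) = (E : ℂ) • ((T g)ᴴ *ᵥ v) := fun g =>
    conjTranspose_mulVec_eigenvector (hTA' g) hAv
  have hwK : ∀ g, (T g)ᴴ *ᵥ v ∈ K := fun g => hTK g v hvK
  have hcard : (Fintype.card G : ℂ) ≠ 0 := Nat.cast_ne_zero.mpr Fintype.card_ne_zero
  set ω := orbitVectorState T v with hω
  have hpos : ∀ a : Matrix n n ℂ, 0 ≤ ω (star a * a) := fun a => by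
    rw [hω, orbitVectorState_apply]
    refine mul_nonneg ?_ (Finset.sum_nonneg fun g _ => vectorState_nonneg _ a)
    rw [← Complex.ofReal_natCast, ← Complex.ofReal_inv]
    exact Complex.zero_le_real.mpr (inv_nonneg.mpr (Nat.cast_nonneg _))
  have hconst : ∀ z : ℂ, (Fintype.card G : ℂ)⁻¹ * ∑ _g : G, z = z := fun z => by
    rw [Finset.sum_const, Finset.card_univ, nsmul_eq_mul, inv_mul_cancel_left₀ hcard]
  have hone : ω 1 = 1 := by
    rw [hω, orbitVectorState_apply]
    simp_rw [vectorState_apply, one_mulVec, hw1]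
    exact hconst 1
  have hnull : ω (∑ k ∈ s, (A * X k - X k * A) + ∑ l ∈ t, (U l * Y l * (U l)ᴴ - Y l) +
      ∑ i ∈ r, (Y₁ i * Z i + Z' i * Y₂ i)) = 0 := by
    rw [map_add, map_add, map_sum, map_sum, map_sum]
    have h1 : ∀ k ∈ s, ω (A * X k - X k * A) = 0 := fun k _ => by
      rw [hω, orbitVectorState_apply]
      simp_rw [vectorState_commutator hA (hAw _)]
      simp
    have h2 : ∀ l ∈ t, ω (U l * Y l * (U l)ᴴ - Y l) = 0 := fun l hl => by
      obtain ⟨σ, hσ⟩ := hUT l hl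
      rw [map_sub, sub_eq_zero, hω, orbitVectorState_apply, orbitVectorState_apply]
      congr 1
      have hre : ∀ g, vectorState ((T g)ᴴ *ᵥ v) (U l * Y l * (U l)ᴴ) =
          vectorState ((T (σ g))ᴴ *ᵥ v) (Y l) := fun g => by
        rw [← vectorState_conjTranspose_mulVec, mulVec_mulVec, ← conjTranspose_mul, hσ g]
      simp_rw [hre]
      exact Equiv.sum_comp σ (fun g => vectorState ((T g)ᴴ *ᵥ v) (Y l))
    have h3 : ∀ i ∈ r, ω (Y₁ i * Z i + Z' i * Y₂ i) = 0 := fun i hi => by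
      rw [hω, orbitVectorState_apply]
      simp_rw [map_add, vectorState_mul_of_mulVec_eq_zero _ _ (hZ i hi _ (hwK _)),
        vectorState_mul_of_conjTranspose_mulVec_eq_zero _ _ (hZ' i hi _ (hwK _))]
      simp
    rw [Finset.sum_eq_zero h1, Finset.sum_eq_zero h2, Finset.sum_eq_zero h3, add_zero, add_zero]
  have hE' : (ω A).re ≤ Eup := by
    rw [hω, orbitVectorState_apply]
    simp_rw [vectorState_apply, hAw, dotProduct_smul, hw1, smul_eq_mul, mul_one]
    rw [hconst, Complex.ofReal_re]
    exact hE
  have hωV : ω V = star v ⬝ᵥ V *ᵥ v := by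
    rw [hω, orbitVectorState_apply]
    simp_rw [vectorState_conjTranspose_mulVec, hV, vectorState_apply]
    exact hconst _
  have h := le_re_map_of_windowCertificate ω hpos hone hΛ O hnull hμ hE' hcert
  rwa [hωV] at h

end MatrixInstances

end

end Summit.HubbardSuperconductivity.HubbardLadder
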